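import Literature.AlgebraicGeometry.Resolution.BlowupAlgebraLift
import Mathlib.RingTheory.Localization.AtPrime.Basic
import Mathlib.RingTheory.Localization.Ideal
import Mathlib.RingTheory.Localization.Basic
import HarnessLib

/-!
# Affine blow-up algebras along a localization: `R'[I R'/a] ⊇ R[I/a]` is a localization, prime by prime
# (crux `FInjectiveMacaulayfication` stmt-ResolutionOfSingularities-15315, chain w45a; T-𝒫 §3a «certificates localise»,
# `L/w45a/ClassGlueSig.lean` v2 `239444958d057f2d`; owner res-D-pv-017 AS res-L1-w45a-stub-5)

Support file for crux stmt-ResolutionOfSingularities-15315 (`FrobeniusLadder.FInjectiveMacaulayfication`), chain w45a.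
[OURS · L1 W4.5a] — NOT a statement of any manuscript; AI-written, weaker than expert review.

For a ring map `φ : R → C` the comparison map `φ̃ : R[1/a] → C[1/φ a]` carries the affine blow-up algebra `R[I/a]` into
`C[IC/φ a]` (`awayMap_mem`), giving a ring map `ψ : R[I/a] → C[IC/φ a]` over `φ` (`exists_map`), injective when `φ` is
(`awayMap_injective`). When `C = R'` is a LOCALIZATION `M⁻¹R` of `R`: every element of `R'[IR'/a]` is `ψ(b) · (m/1)⁻¹` with
`b ∈ R[I/a]`, `m ∈ M` (`exists_mul_algebraMap_eq_map`), so for every prime `Q'` of `R'[IR'/a]` the local ring `R'[IR'/a]_{Q'}` is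
the localization of `R[I/a]` at `ψ⁻¹ Q'` (`nonempty_ringEquiv_atPrime_comap`, for `R → R'` injective). This is the algebra behind
«E6‴ chart certificates survive `R ↦ R[1/s]`» (T-𝒫 §3a). No definitions, no named facts. [folklore; cf. Stacks 0BIP/080V flat base
change of blow-up algebras]
-/

-- single-problem summit: the doubled namespace component is forced
set_option linter.dupNamespace false

noncomputable section

open Literature.AlgebraicGeometry.Resolution IsLocalization

namespace Summit.ResolutionOfSingularities.ResolutionOfSingularities.Theorems.FInjectiveMacaulayfication.BlowupAlgebraLocalization

/-! ## Functoriality of `R[I/a]` along a ring map -/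

/-- **`φ̃ (R[I/a]) ⊆ C[IC/φ a]`**: the comparison map `R[1/a] → C[1/φ a]` sends the generators `x/a`, `x ∈ I`, to the generators
`φ x/φ a`. [folklore] -/
theorem awayMap_mem {R C : Type*} [CommRing R] [CommRing C] (I : Ideal R) (a : R) (φ : R →+* C)
    {y : Localization.Away a} (hy : y ∈ blowupAlgebra I a) :
    blowupAlgebra.awayMap a φ y ∈ blowupAlgebra (I.map φ) (φ a) := by
  refine Algebra.adjoin_induction (hx := hy) ?_ ?_ ?_ ?_
  · rintro _ ⟨x, hx, rfl⟩
    rw [map_mul, blowupAlgebra.awayMap_algebraMap, blowupAlgebra.awayMap_invSelf]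
    exact div_mem_blowupAlgebra (I.map φ) (φ a) (Ideal.mem_map_of_mem φ hx)
  · intro r
    rw [blowupAlgebra.awayMap_algebraMap]
    exact Subalgebra.algebraMap_mem _ (φ r)
  · rintro x y - - hx hy
    rw [map_add]
    exact Subalgebra.add_mem _ hx hy
  · rintro x y - - hx hy
    rw [map_mul]
    exact Subalgebra.mul_mem _ hx hy

/-- **The ring map `ψ : R[I/a] → C[IC/φ a]` over `φ`** (the restriction of `φ̃ : R[1/a] → C[1/φ a]`). [folklore] -/
theorem exists_map {R C : Type*} [CommRing R] [CommRing C] (I : Ideal R) (a : R) (φ : R →+* C) :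
    ∃ ψ : blowupAlgebra I a →+* blowupAlgebra (I.map φ) (φ a),
      ∀ y : blowupAlgebra I a, (ψ y : Localization.Away (φ a)) = blowupAlgebra.awayMap a φ y :=
  ⟨((blowupAlgebra.awayMap a φ).comp (blowupAlgebra I a).val.toRingHom).codRestrict (blowupAlgebra (I.map φ) (φ a))
    fun y => awayMap_mem I a φ y.2, fun _ => rfl⟩

/-- `ψ (r/1) = φ r/1`. [folklore] -/
theorem map_algebraMap {R C : Type*} [CommRing R] [CommRing C] {I : Ideal R} {a : R} {φ : R →+* C}
    {ψ : blowupAlgebra I a →+* blowupAlgebra (I.map φ) (φ a)}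
    (hψ : ∀ y : blowupAlgebra I a, (ψ y : Localization.Away (φ a)) = blowupAlgebra.awayMap a φ y) (r : R) :
    ψ (algebraMap R (blowupAlgebra I a) r) = algebraMap C (blowupAlgebra (I.map φ) (φ a)) (φ r) :=
  Subtype.ext ((hψ _).trans (blowupAlgebra.awayMap_algebraMap a φ r))

/-- `ψ (x/a) = φ x/φ a` for `x ∈ I`. [folklore] -/
theorem map_div {R C : Type*} [CommRing R] [CommRing C] {I : Ideal R} {a : R} {φ : R →+* C}
    {ψ : blowupAlgebra I a →+* blowupAlgebra (I.map φ) (φ a)}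
    (hψ : ∀ y : blowupAlgebra I a, (ψ y : Localization.Away (φ a)) = blowupAlgebra.awayMap a φ y) {x : R} (hx : x ∈ I) :
    ψ ⟨_, div_mem_blowupAlgebra I a hx⟩ = ⟨_, div_mem_blowupAlgebra (I.map φ) (φ a) (Ideal.mem_map_of_mem φ hx)⟩ := by
  apply Subtype.ext
  rw [hψ]
  change blowupAlgebra.awayMap a φ (algebraMap R (Localization.Away a) x * Away.invSelf a) = _
  rw [map_mul, blowupAlgebra.awayMap_algebraMap, blowupAlgebra.awayMap_invSelf]

/-- **`φ̃ : R[1/a] → C[1/φ a]` is injective when `φ` is**: `φ x/φ aⁿ = 0` forces `φ(aᵉ x) = 0`, so `aᵉ x = 0`. [folklore] -/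
theorem awayMap_injective {R C : Type*} [CommRing R] [CommRing C] (a : R) {φ : R →+* C} (hφ : Function.Injective φ) :
    Function.Injective (blowupAlgebra.awayMap a φ) := by
  rw [injective_iff_map_eq_zero]
  intro z hz
  obtain ⟨x, u, rfl⟩ := IsLocalization.mk'_surjective (Submonoid.powers a) z
  rw [blowupAlgebra.awayMap, IsLocalization.map_mk', IsLocalization.mk'_eq_zero_iff] at hz
  obtain ⟨⟨_, e, rfl⟩, he⟩ := hz
  rw [IsLocalization.mk'_eq_zero_iff]
  refine ⟨⟨a ^ e, e, rfl⟩, hφ ?_⟩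
  rw [map_mul, map_zero, map_pow]
  exact he

/-- `ψ : R[I/a] → C[IC/φ a]` is injective when `φ` is. [folklore] -/
theorem map_injective {R C : Type*} [CommRing R] [CommRing C] {I : Ideal R} {a : R} {φ : R →+* C} (hφ : Function.Injective φ)
    {ψ : blowupAlgebra I a →+* blowupAlgebra (I.map φ) (φ a)}
    (hψ : ∀ y : blowupAlgebra I a, (ψ y : Localization.Away (φ a)) = blowupAlgebra.awayMap a φ y) :
    Function.Injective ψ := fun x y h =>
  Subtype.ext (awayMap_injective a hφ (by rw [← hψ, ← hψ, h]))

/-! ## Along a localization `R → R' = M⁻¹R` -/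

/-- **Every element of `R'[IR'/a]` is `ψ(b) · (m/1)⁻¹`** with `b ∈ R[I/a]` and `m ∈ M`, when `R' = M⁻¹R`: on the generators,
`x'/a` with `x' · m = x ∈ I` is `ψ(x/a) · (m/1)⁻¹`. [folklore] -/
theorem exists_mul_algebraMap_eq_map {R R' : Type*} [CommRing R] [CommRing R'] [Algebra R R'] (M : Submonoid R)
    [IsLocalization M R'] (I : Ideal R) (a : R)
    {ψ : blowupAlgebra I a →+* blowupAlgebra (I.map (algebraMap R R')) (algebraMap R R' a)}
    (hψ : ∀ y : blowupAlgebra I a, (ψ y : Localization.Away (algebraMap R R' a)) = blowupAlgebra.awayMap a (algebraMap R R') y)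
    (b' : blowupAlgebra (I.map (algebraMap R R')) (algebraMap R R' a)) :
    ∃ (b : blowupAlgebra I a) (m : M),
      b' * algebraMap R' (blowupAlgebra (I.map (algebraMap R R')) (algebraMap R R' a)) (algebraMap R R' m) = ψ b := by
  obtain ⟨y, hy⟩ := b'
  refine Algebra.adjoin_induction (hx := hy) (p := fun y hy => ∃ (b : blowupAlgebra I a) (m : M),
      (⟨y, hy⟩ : blowupAlgebra (I.map (algebraMap R R')) (algebraMap R R' a)) *
        algebraMap R' (blowupAlgebra (I.map (algebraMap R R')) (algebraMap R R' a)) (algebraMap R R' m) = ψ b) ?_ ?_ ?_ ?_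
  · rintro _ ⟨x', hx', rfl⟩
    obtain ⟨⟨⟨x, hx⟩, m⟩, hxm⟩ := (IsLocalization.mem_map_algebraMap_iff M R').mp hx'
    refine ⟨⟨_, div_mem_blowupAlgebra I a hx⟩, m, ?_⟩
    rw [map_div hψ hx]
    apply Subtype.ext
    change algebraMap R' (Localization.Away (algebraMap R R' a)) x' * Away.invSelf (algebraMap R R' a) *
        algebraMap R' (Localization.Away (algebraMap R R' a)) (algebraMap R R' m) =
      algebraMap R' (Localization.Away (algebraMap R R' a)) (algebraMap R R' x) * Away.invSelf (algebraMap R R' a)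
    rw [mul_right_comm, ← map_mul, hxm]
  · intro r'
    obtain ⟨⟨r, m⟩, hrm⟩ := IsLocalization.surj M r'
    refine ⟨algebraMap R (blowupAlgebra I a) r, m, ?_⟩
    rw [map_algebraMap hψ, ← hrm, map_mul]
    rfl
  · rintro x y hx' hy' ⟨b₁, m₁, h₁⟩ ⟨b₂, m₂, h₂⟩
    refine ⟨b₁ * algebraMap R (blowupAlgebra I a) m₂ + b₂ * algebraMap R (blowupAlgebra I a) m₁, m₁ * m₂, ?_⟩
    have hxy : (⟨x + y, Subalgebra.add_mem _ hx' hy'⟩ : blowupAlgebra (I.map (algebraMap R R')) (algebraMap R R' a)) =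
        ⟨x, hx'⟩ + ⟨y, hy'⟩ := rfl
    rw [hxy, map_add, map_mul, map_mul, ← h₁, ← h₂, map_algebraMap hψ, map_algebraMap hψ, Submonoid.coe_mul, map_mul,
      map_mul]
    ring
  · rintro x y hx' hy' ⟨b₁, m₁, h₁⟩ ⟨b₂, m₂, h₂⟩
    refine ⟨b₁ * b₂, m₁ * m₂, ?_⟩
    have hxy : (⟨x * y, Subalgebra.mul_mem _ hx' hy'⟩ : blowupAlgebra (I.map (algebraMap R R')) (algebraMap R R' a)) =
        ⟨x, hx'⟩ * ⟨y, hy'⟩ := rfl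
    rw [hxy, map_mul, ← h₁, ← h₂, Submonoid.coe_mul, map_mul, map_mul]
    ring

/-- **`R'[IR'/a]_{Q'} ≅ R[I/a]_{ψ⁻¹Q'}`** for `R' = M⁻¹R` with `R → R'` injective and any prime `Q'` of `R'[IR'/a]`: the local ring
of the base-changed chart is the localization of the original chart at the contracted prime. [folklore] -/
theorem nonempty_ringEquiv_atPrime_comap {R R' : Type*} [CommRing R] [CommRing R'] [Algebra R R'] (M : Submonoid R)
    [IsLocalization M R'] (hinj : Function.Injective (algebraMap R R')) (I : Ideal R) (a : R)
    {ψ : blowupAlgebra I a →+* blowupAlgebra (I.map (algebraMap R R')) (algebraMap R R' a)}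
    (hψ : ∀ y : blowupAlgebra I a, (ψ y : Localization.Away (algebraMap R R' a)) = blowupAlgebra.awayMap a (algebraMap R R') y)
    (Q' : Ideal (blowupAlgebra (I.map (algebraMap R R')) (algebraMap R R' a))) [Q'.IsPrime] :
    Nonempty (Localization.AtPrime (Q'.comap ψ) ≃+* Localization.AtPrime Q') := by
  have hψinj := map_injective hinj hψ
  -- units of `R'` coming from `M`, seen in `R'[IR'/a]`
  have hunit : ∀ m : M, IsUnit (algebraMap R' (blowupAlgebra (I.map (algebraMap R R')) (algebraMap R R' a)) (algebraMap R R' m)) :=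
    fun m => (IsLocalization.map_units R' m).map _
  have hnot : ∀ m : M, algebraMap R' (blowupAlgebra (I.map (algebraMap R R')) (algebraMap R R' a)) (algebraMap R R' m) ∉ Q' :=
    fun m hm => Ideal.IsPrime.ne_top inferInstance (Ideal.eq_top_of_isUnit_mem _ hm (hunit m))
  letI alg : Algebra (blowupAlgebra I a) (Localization.AtPrime Q') :=
    ((algebraMap (blowupAlgebra (I.map (algebraMap R R')) (algebraMap R R' a)) (Localization.AtPrime Q')).comp ψ).toAlgebra
  have halg : ∀ b : blowupAlgebra I a, algebraMap (blowupAlgebra I a) (Localization.AtPrime Q') b =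
      algebraMap (blowupAlgebra (I.map (algebraMap R R')) (algebraMap R R' a)) (Localization.AtPrime Q') (ψ b) := fun _ => rfl
  haveI : IsLocalization.AtPrime (Localization.AtPrime Q') (Q'.comap ψ) := by
    refine (isLocalization_iff _ _).mpr ⟨?_, ?_, ?_⟩
    · rintro ⟨y, hy⟩
      rw [halg]
      exact IsLocalization.map_units (Localization.AtPrime Q') (⟨ψ y, hy⟩ : Q'.primeCompl)
    · intro z
      obtain ⟨⟨b', u'⟩, h⟩ := IsLocalization.surj Q'.primeCompl z
      obtain ⟨b, m₁, h₁⟩ := exists_mul_algebraMap_eq_map M I a hψ b'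
      obtain ⟨u, m₂, h₂⟩ := exists_mul_algebraMap_eq_map M I a hψ (u' : blowupAlgebra (I.map (algebraMap R R')) (algebraMap R R' a))
      have hu : u * algebraMap R (blowupAlgebra I a) m₁ ∈ (Q'.comap ψ).primeCompl := by
        rw [Ideal.mem_primeCompl_iff, Ideal.mem_comap, map_mul, ← h₂, map_algebraMap hψ]
        exact fun hmem => (Ideal.IsPrime.mem_or_mem inferInstance hmem).elim
          (fun hmem' => (Ideal.IsPrime.mem_or_mem inferInstance hmem').elim u'.2 (hnot m₂)) (hnot m₁)
      refine ⟨⟨b * algebraMap R (blowupAlgebra I a) m₂, ⟨_, hu⟩⟩, ?_⟩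
      change z * algebraMap (blowupAlgebra I a) (Localization.AtPrime Q') (u * algebraMap R (blowupAlgebra I a) m₁) =
        algebraMap (blowupAlgebra I a) (Localization.AtPrime Q') (b * algebraMap R (blowupAlgebra I a) m₂)
      rw [halg, halg]
      simp only [map_mul]
      rw [← h₁, ← h₂, map_algebraMap hψ, map_algebraMap hψ]
      simp only [map_mul]
      rw [← h]
      ring
    · intro x y h
      rw [halg, halg] at h
      obtain ⟨c', hc'⟩ := IsLocalization.exists_of_eq (M := Q'.primeCompl) h
      obtain ⟨c, m, hc⟩ := exists_mul_algebraMap_eq_map M I a hψ (c' : blowupAlgebra (I.map (algebraMap R R')) (algebraMap R R' a))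
      have hcq : c ∈ (Q'.comap ψ).primeCompl := by
        rw [Ideal.mem_primeCompl_iff, Ideal.mem_comap, ← hc]
        exact fun hmem => (Ideal.IsPrime.mem_or_mem inferInstance hmem).elim c'.2 (hnot m)
      refine ⟨⟨c, hcq⟩, hψinj ?_⟩
      change ψ (c * x) = ψ (c * y)
      rw [map_mul, map_mul, ← hc, mul_right_comm, hc', mul_right_comm]
  exact ⟨(IsLocalization.algEquiv (Q'.comap ψ).primeCompl (Localization.AtPrime (Q'.comap ψ)) (Localization.AtPrime Q')).toRingEquiv⟩

end Summit.ResolutionOfSingularities.ResolutionOfSingularities.Theorems.FInjectiveMacaulayfication.BlowupAlgebraLocalization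

end
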